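/-
Copyright (c) 2026 the pub-hodgecm-mathlib formalisation cell (harness21).  Prover seat hodgecm-mathlib-K2E1b-p01 (g0),
Track B «K2-LIT» ∕ h413, unit U0 «TWIST INTEGRATION» of the line `K2_E1b_GKCohomologyU21`, file #3: payment of the socket
`K2E1bGKCohomologyU21.U0.sig_K2E1bKovLieTwist` — THE CENTRAL TWIST OF A `𝔤𝔩(3, ℂ)`-MODULE EXISTS AS A REAL LIE
HOMOMORPHISM `𝔲(2,1) → End_ℂ V`.  2026-09-03.
-/
import Summits.HodgeConjecture.HodgeConjecture.Theorems.K2E1bKTypeTwistDefs   -- ★ defs leaf: `IsTwistOf` (p854741); brings `kovLie`, `G21`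
import Literature.NumberTheory.Automorphic.GKModuleSubrepTwist                -- ★ `RealMatrixGroup.twistLie` (generic `dτ + dc·1`)
import HarnessLib

/-!
# K2_E1b road (h413 = stmt-HodgeConjecture-24833), unit U0 «TWIST INTEGRATION», file #3:
# the central twist `X ↦ kovLie ρ X + z·tr(X)·1` is a real Lie homomorphism `𝔲(2,1) → End_ℂ V`

Cell `pub/hodgecm-mathlib` (D-0151), Track B (21-frontier RULING «PUSH BOTH» 2026-09-03, director req621∕req624,
chair K2-lead ORDER #1 §4.4 ∕ ORDER #2, SKELETON LANDED K2E1b l.72387), socket module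
`Summits/HodgeConjecture/HodgeConjecture/Cruxes/H413/Lines/K2_E1b_GKCohomologyU21_U0_TwistIntegration.lean`
(planner K2E1b-plan (g0)), socket **`sig_K2E1bKovLieTwist`** (SIGS TABLE #3, size S, first rung):
for every complex vector space `V`, every `𝔤𝔩(3, ℂ)`-module structure `ρ : 𝔤𝔩(3, ℂ) →ₗ⁅ℂ⁆ End_ℂ V` and every `z ∈ ℂ`
there is a real Lie homomorphism `σ : 𝔲(2,1) →ₗ⁅ℝ⁆ End_ℂ V` with `σ(X) = kovLie ρ X + z·tr(X)·1` for all `X ∈ 𝔲(2,1)`,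
i.e. `IsTwistOf ρ z σ` (★ defs leaf `Theorems/K2E1bKTypeTwistDefs`).  This is the CENTRAL TWIST by which unit U0 passes
from Kovačević's `K`-type modules (centre acting by `0`, ★ `SU21Datum.ρfun_one`) to Rogawski's `J^±_φ`, `D_φ`, `π²_φ` with
central character `u ↦ u^{e(φ)}`, `e = a + b + c` [Rogawski1990, §12.3 pp. 176–177: «the center of the enveloping algebra
of G acts by the same character by which it acts on F_φ»]; the twist of a `(𝔤, K)`-action by a one-dimensional character
is [KnappVogan1995, Prop. 4.120 ∕ §II.3 (2.38)].

THE MATHEMATICS.  `X ↦ z·tr(X)` is a morphism of real Lie algebras `𝔲(2,1) → ℂ` (target abelian) because the trace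
kills commutators, `tr(XY) = tr(YX)` (Mathlib `Matrix.trace_mul_comm`); and for ANY real Lie morphism `dτ : 𝔤 → End_ℂ V`
and ANY infinitesimal character `dc : 𝔤 → ℂ` the map `X ↦ dτ(X) + dc(X)·1` is again a Lie morphism, since scalar operators
are central in `End_ℂ V` — this second step is the tree's ★ generic construction
`Literature.NumberTheory.Automorphic.RealMatrixGroup.twistLie` (`Literature/NumberTheory/Automorphic/GKModuleSubrepTwist`),
REUSED BY NAME with `G = G21 = U(2,1)`, `dτ = kovLie ρ` (★ `F0P3bU21Restriction`), `dc = z·tr` — nothing is re-derived.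

* §1 `trace_coe_lie` — `tr ⁅X, Y⁆ = 0` for `X, Y ∈ 𝔲(2,1)` (one `rw` chain on `Matrix.trace_mul_comm`).
* §2 **`kovLieTwist`** — `sig_K2E1bKovLieTwist` TOKEN FOR TOKEN; witness `σ := twistLie G21 (kovLie ρ) ⟨z·tr, …⟩`, and
  `IsTwistOf ρ z σ` holds by `rfl` (the defining formula of ★ `twistLie`).

HONEST LABEL: HC_CM is proved only modulo the 7 printed citations (2 remaining named inputs: hLiu418 =
stmt-HodgeConjecture-24832, h413 = stmt-HodgeConjecture-24833) until rung 0 closes; this file is a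
`--supports stmt-HodgeConjecture-24833 --as helper` leaf (first rung of unit U0 of the K2_E1b road) and retires nothing by itself.
-/

set_option autoImplicit false
set_option linter.dupNamespace false   -- `Summit.HodgeConjecture.HodgeConjecture.…` (D-0017 nested layout; lakefile exemption for Summits)

noncomputable section

namespace Summit.HodgeConjecture.HodgeConjecture.Cruxes.H413.K2E1bKovLieTwist

open Literature.NumberTheory.Automorphic
open Literature.RepresentationTheory.KonnoKonno2007 Literature.RepresentationTheory.KonnoKonno2007.RealDualPair
open Literature.RepresentationTheory.KonnoKonno2007.RealDualPair.UForm
open Summit.HodgeConjecture.HodgeConjecture.Cruxes.H413.F0P3bLocalAPacketsDefs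
open Summit.HodgeConjecture.HodgeConjecture.Cruxes.H413.F0P3bU21Restriction
open Summit.HodgeConjecture.HodgeConjecture.Cruxes.H413.K2E1bGKCohomologyU21 (IsTwistOf)

-- Mathlib idiom (as in ★ `F0P3bU21Restriction`, ★ `GKModuleSubrepTwist`, the defs leaf): commutator bracket on `Module.End` ∕ matrices
attribute [local instance 100] LieRing.ofAssociativeRing

/-! ## §1  The trace kills brackets in `𝔲(2,1)` -/

/-- The trace kills brackets: for `X, Y ∈ 𝔲(2,1)` (indeed in any real Lie subalgebra of a matrix algebra)
`tr ⁅X, Y⁆ = tr (XY) − tr (YX) = 0` (Mathlib `Matrix.trace_mul_comm`). [folklore] -/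
theorem trace_coe_lie (X Y : G21.lie) :
    ((⁅X, Y⁆ : G21.lie) : Matrix (Fin 2 ⊕ Fin 1) (Fin 2 ⊕ Fin 1) ℂ).trace = 0 := by
  rw [LieSubalgebra.coe_bracket, LieRing.of_associative_ring_bracket, Matrix.trace_sub, Matrix.trace_mul_comm, sub_self]

/-! ## §2  The head -/

/-- **PAYMENT OF `sig_K2E1bKovLieTwist`** (socket #3 of unit U0 «TWIST INTEGRATION» of the K2_E1b road,
`Cruxes/H413/Lines/K2_E1b_GKCohomologyU21_U0_TwistIntegration.lean`, TOKEN FOR TOKEN): for every `𝔤𝔩(3, ℂ)`-module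
`ρ` on a complex vector space `V` and every `z ∈ ℂ`, the central twist `X ↦ kovLie ρ X + z·tr(X)·1` is a real Lie
homomorphism `σ : 𝔲(2,1) → End_ℂ V`, i.e. `∃ σ, IsTwistOf ρ z σ`.  Witness: the tree's generic twist-by-a-character
★ `RealMatrixGroup.twistLie G21 (kovLie ρ) dc` with the infinitesimal character `dc = z·tr : 𝔲(2,1) →ₗ⁅ℝ⁆ ℂ` (a Lie
morphism to abelian `ℂ` by §1); the predicate `IsTwistOf` then holds definitionally (`rfl`).  Rogawski: the centre of
`U(𝔤)` acts on `J^±_φ`, `D_φ`, `π²_φ` by the character of `F_φ`; Knapp–Vogan: tensoring a `(𝔤, K)`-module with a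
one-dimensional character.
[cite: Rogawski1990, §12.3 p. 177] [cite: KnappVogan1995, Prop. 4.120] -/
theorem kovLieTwist :
    ∀ (V : Type) [AddCommGroup V] [Module ℂ V] (ρ : Matrix (Fin 3) (Fin 3) ℂ →ₗ⁅ℂ⁆ Module.End ℂ V) (z : ℂ),
      ∃ σ : G21.lie →ₗ⁅ℝ⁆ Module.End ℂ V, IsTwistOf ρ z σ := by
  intro V _ _ ρ z
  exact ⟨RealMatrixGroup.twistLie G21 (kovLie ρ)
      { toFun := fun X => z * (X : Matrix (Fin 2 ⊕ Fin 1) (Fin 2 ⊕ Fin 1) ℂ).trace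
        map_add' := fun X Y => by
          show z * ((X + Y : G21.lie) : Matrix (Fin 2 ⊕ Fin 1) (Fin 2 ⊕ Fin 1) ℂ).trace =
            z * (X : Matrix (Fin 2 ⊕ Fin 1) (Fin 2 ⊕ Fin 1) ℂ).trace + z * (Y : Matrix (Fin 2 ⊕ Fin 1) (Fin 2 ⊕ Fin 1) ℂ).trace
          rw [show ((X + Y : G21.lie) : Matrix (Fin 2 ⊕ Fin 1) (Fin 2 ⊕ Fin 1) ℂ) = X + Y from rfl, Matrix.trace_add, mul_add]
        map_smul' := fun t X => by
          show z * ((t • X : G21.lie) : Matrix (Fin 2 ⊕ Fin 1) (Fin 2 ⊕ Fin 1) ℂ).trace =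
            t • (z * (X : Matrix (Fin 2 ⊕ Fin 1) (Fin 2 ⊕ Fin 1) ℂ).trace)
          rw [show ((t • X : G21.lie) : Matrix (Fin 2 ⊕ Fin 1) (Fin 2 ⊕ Fin 1) ℂ) = t • (X : Matrix (Fin 2 ⊕ Fin 1) (Fin 2 ⊕ Fin 1) ℂ)
            from rfl, Matrix.trace_smul, mul_smul_comm]
        map_lie' := fun {X Y} => by
          show z * ((⁅X, Y⁆ : G21.lie) : Matrix (Fin 2 ⊕ Fin 1) (Fin 2 ⊕ Fin 1) ℂ).trace =
            ⁅z * (X : Matrix (Fin 2 ⊕ Fin 1) (Fin 2 ⊕ Fin 1) ℂ).trace, z * (Y : Matrix (Fin 2 ⊕ Fin 1) (Fin 2 ⊕ Fin 1) ℂ).trace⁆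
          rw [trace_coe_lie, mul_zero, LieRing.of_associative_ring_bracket, mul_comm, sub_self] },
    fun _ => rfl⟩

end Summit.HodgeConjecture.HodgeConjecture.Cruxes.H413.K2E1bKovLieTwist

end
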